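import Summits.Parity.GeneralizedHardyLittlewood.Theorems.LeeYangFibresAbsoluteUpgradeSinglesDecaySeq
import Summits.Parity.GeneralizedHardyLittlewood.Theorems.LeeYangFibresAbsoluteUpgradeSinglesDecayDict
import HarnessLib

/-!
# Route `LeeYangFibres`, crux `AbsoluteUpgrade` (stmt-Parity-14116), line `nlc-cells-absolute-clip`:
# helper file 7 for the stub `stub_singlesDecay` — the two applications of the Fundamental Lemma

Both statements are about an arbitrary `F ∈ ℤ[X]` whose root density `ω_F(m)/m` has a sieve dimension,
an integer interval `I = [m₁, m₂]` on which `F > 0` (values `≤ x_F`), a sifting level `2 ≤ z ≤ D`, and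
a constant `C_FL` for which the (uniform) Fundamental Lemma holds (in the tree:
`SieveSequence.fundamental_lemma_uniform_holds`, Friedlander–Iwaniec, *Opera de Cribro*, Cor. 6.10);
`V(z) = ∏_{p<z} (1 − ω_F(p)/p)`.

* `signed_sifted_sum_le` — **parity of a form over the sifted points.**  For a form `a m + b ≥ 1` on
  `I`: `|∑_{m ∈ I, (F(m), P(z)) = 1} λ(a m + b)| ≤ C_FL · #I · V(z) · e^{−log D/log z} +
  ∑_{d ≤ D sqfree} ∑_{s mod d, d ∣ F(s)} (1 + |∑_{m ∈ I, m ≡ s (d)} λ(a m + b)|)`.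
  Proof: split by the sign `ν = λ(a m + b)` into the two value sequences `valSeq F S_ν (#I/2)`
  (helper file 1); both have density `ω_F(m)/m` and size `#I/2`, so the two main terms `X V(z)` of the
  Fundamental Lemma CANCEL, leaving `2 C_FL (#I/2) V(z) e^{-s}`; the class counts of `S_ν` are
  `½ #{m ∈ I : m ≡ s} + ½ ν ∑_{m ≡ s} λ(a m + b)` (helper file 6), whence the remainders.
* `sifted_card_le` — the plain upper bound `#{m ∈ I : (F(m), P(z)) = 1} ≤ (1 + C_FL) #I V(z) +
  ∑_{d ≤ D sqfree} ω_F(d)` (remainders `|R_d| ≤ ω_F(d)`).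

References: J. Friedlander, H. Iwaniec, *Opera de Cribro* (2010), Cor. 6.10
[FriedlanderIwaniecOpera2010]; H. Halberstam, H.-E. Richert, *Sieve Methods* (1974), Thm. 2.5 and
§5.7 [HalberstamRichert1974].
-/

noncomputable section

open Finset Polynomial ArithmeticFunction

namespace Summit.Parity.GeneralizedHardyLittlewood.Theorems.AbsoluteUpgrade

open Literature.NumberTheory.Sieve

/-- `∑_{m ∈ T} λ(a m + b) = #{λ = 1} − #{λ = −1}` when `a m + b ≥ 1` on `T`. [folklore] -/
theorem sum_liouville_eq_card_sub_card (T : Finset ℤ) {a b : ℤ} (hT : ∀ m ∈ T, 1 ≤ a * m + b) :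
    ∑ m ∈ T, (liouville (a * m + b).toNat : ℝ) =
      (#(T.filter (fun m : ℤ => liouville (a * m + b).toNat = 1)) : ℝ) -
        #(T.filter (fun m : ℤ => liouville (a * m + b).toNat = -1)) := by
  rw [Finset.card_eq_sum_ones, Finset.card_eq_sum_ones, Nat.cast_sum, Nat.cast_sum,
    Finset.sum_filter, Finset.sum_filter, ← Finset.sum_sub_distrib]
  refine Finset.sum_congr rfl fun m hm => ?_
  have hm0 : (a * m + b).toNat ≠ 0 := by have := hT m hm; omega
  rcases liouville_eq_one_or_eq_neg_one hm0 with h | h <;> simp [h]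

/-- The moduli `d ∣ P(z)`, `d ≤ D` are squarefree numbers in `[1, ⌊D⌋]`. [folklore] -/
theorem divisors_filter_subset (z D : ℝ) :
    (primesProdBelow z).divisors.filter (fun d : ℕ => (d : ℝ) ≤ D) ⊆ (Icc 1 ⌊D⌋₊).filter Squarefree := by
  intro d hd
  rw [Finset.mem_filter, Nat.mem_divisors] at hd
  rw [Finset.mem_filter, Finset.mem_Icc]
  exact ⟨⟨Nat.pos_of_dvd_of_pos hd.1.1 (Nat.pos_of_ne_zero hd.1.2), Nat.le_floor hd.2⟩,
    (squarefree_primesProdBelow z).squarefree_of_dvd hd.1.1⟩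

/-- `0 ≤ V(z) = ∏_{p<z} (1 − ω_F(p)/p)`. [folklore] -/
theorem prod_one_sub_rootCount_nonneg (F : ℤ[X]) (z : ℝ) :
    0 ≤ ∏ p ∈ Nat.primesBelow ⌈z⌉₊, (1 - (polyRootCountMod ![F] p : ℝ) / p) :=
  Finset.prod_nonneg fun p _ => by
    have := rootDensity_le_one F p
    rw [rootDensity_apply] at this
    linarith

set_option maxHeartbeats 800000 in
/-- **Parity of a form over the sifted points (the two main terms cancel).** See the module
docstring. [cite: FriedlanderIwaniecOpera2010, Cor. 6.10] -/
theorem signed_sifted_sum_le : ∀ {κ K CFL : ℝ}, (∀ A : SieveSequence, HasSieveDimension A.density κ K → ∀ x z D : ℝ, 2 ≤ z → z ≤ D → 0 ≤ A.size x → |A.sifted x (primesProdBelow z) - A.size x * A.densityProduct (primesProdBelow z)| ≤ CFL * A.size x * A.densityProduct (primesProdBelow z) * Real.exp (-(Real.log D / Real.log z)) + ∑ d ∈ (primesProdBelow z).divisors.filter (fun d : ℕ => (d : ℝ) ≤ D), |A.remainder d x|) → ∀ {F : Polynomial ℤ}, HasSieveDimension (rootDensity F) κ K → ∀ {a b m₁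 m₂ : ℤ}, (∀ m ∈ Icc m₁ m₂, 1 ≤ a * m + b) → ∀ {xF : ℝ}, (∀ m ∈ Icc m₁ m₂, 0 < F.eval m ∧ ((F.eval m : ℤ) : ℝ) ≤ xF) → ∀ {z D : ℝ}, 2 ≤ z → z ≤ D → |∑ m ∈ (Icc m₁ m₂).filter (fun m : ℤ => (F.eval m).natAbs.Coprime (primesProdBelow z)), (liouville (a * m + b).toNat : ℝ)| ≤ CFL * #(Icc m₁ m₂) * (∏ p ∈ Nat.primesBelow ⌈z⌉₊, (1 - (polyRootCountMod ![F] p : ℝ) / p)) * Real.exp (-(Real.log D / Real.log z)) + ∑ d ∈ (Icc 1 ⌊D⌋₊).filter Squarefree, ∑ s ∈ rootsMod F d, (1 + |∑ m ∈ (Icc m₁ m₂).filter (fun m : ℤ => m ≡ (s : ℤ) [ZMOD d]), (liouville (a * m + b).toNat : ℝ)|) := by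
  intro κ K CFL hFL F hdim a b m₁ m₂ hab xF hxF z D hz hzD
  set I := Icc m₁ m₂ with hIdef
  set P := primesProdBelow z with hP
  set V := ∏ p ∈ Nat.primesBelow ⌈z⌉₊, (1 - (polyRootCountMod ![F] p : ℝ) / p) with hVdef
  set E := Real.exp (-(Real.log D / Real.log z)) with hE
  set X : ℝ := #I / 2 with hX
  set Lam : ℕ → ℕ → ℝ := fun d s => ∑ m ∈ I.filter (fun m : ℤ => m ≡ (s : ℤ) [ZMOD d]),
    (liouville (a * m + b).toNat : ℝ) with hLam
  set S : ℤ → Finset ℤ := fun ν => I.filter (fun m : ℤ => liouville (a * m + b).toNat = ν) with hS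
  have hxS : ∀ ν, ∀ m ∈ S ν, 0 < F.eval m ∧ ((F.eval m : ℤ) : ℝ) ≤ xF := fun ν m hm =>
    hxF m (Finset.mem_filter.mp hm).1
  set A : ℤ → SieveSequence := fun ν => valSeq F (S ν) X with hA
  have hX0 : 0 ≤ X := by positivity
  have hV0 : 0 ≤ V := prod_one_sub_rootCount_nonneg F z
  -- the sifted sums count the sign classes of the sifted points
  have hsift : ∀ ν, (A ν).sifted xF P =
      #((I.filter (fun m : ℤ => (F.eval m).natAbs.Coprime P)).filter
        (fun m : ℤ => liouville (a * m + b).toNat = ν)) := by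
    intro ν
    rw [hA, valSeq_sifted F (S ν) X (hxS ν) P, hS, Finset.filter_filter, Finset.filter_filter]
    congr 2
    refine Finset.filter_congr fun m _ => ?_
    exact and_comm
  have hsize : ∀ ν x, (A ν).size x = X := fun ν x => rfl
  have hdens : ∀ ν, (A ν).densityProduct P = V := fun ν => valSeq_densityProduct F (S ν) X z
  -- the Fundamental Lemma for each sign
  have hFLν : ∀ ν, |(A ν).sifted xF P - X * V| ≤ CFL * X * V * E +
      ∑ d ∈ P.divisors.filter (fun d : ℕ => (d : ℝ) ≤ D), |(A ν).remainder d xF| := by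
    intro ν
    have h := hFL (A ν) hdim xF z D hz hzD (by rw [hsize]; exact hX0)
    rwa [hdens ν, hsize] at h
  -- the remainders, class by class
  have hRd : ∀ ν : ℤ, (ν = 1 ∨ ν = -1) → ∀ d ∈ P.divisors.filter (fun d : ℕ => (d : ℝ) ≤ D),
      |(A ν).remainder d xF| ≤ (1 / 2) * ∑ s ∈ rootsMod F d, (1 + |Lam d s|) := by
    intro ν hν d hd
    have hd0 : 0 < d := Nat.pos_of_mem_divisors (Finset.mem_filter.mp hd).1
    refine (abs_valSeq_remainder_le F (S ν) X (hxS ν) hd0).trans ?_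
    rw [Finset.mul_sum]
    refine Finset.sum_le_sum fun s _ => ?_
    have hset : (S ν).filter (fun n : ℤ => n ≡ (s : ℤ) [ZMOD d]) =
        (I.filter (fun m : ℤ => m ≡ (s : ℤ) [ZMOD d])).filter
          (fun m : ℤ => liouville (a * m + b).toNat = ν) := by
      rw [hS, Finset.filter_filter, Finset.filter_filter]
      exact Finset.filter_congr fun m _ => and_comm
    have hcl := card_filter_liouville_eq (I.filter (fun m : ℤ => m ≡ (s : ℤ) [ZMOD d]))
      (fun m hm => hab m (Finset.mem_filter.mp hm).1) hν
    have hcnt := abs_card_Icc_filter_modEq_sub_le hd0 m₁ m₂ (s : ℤ)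
    rw [hset, hcl]
    have hνabs : |((ν : ℤ) : ℝ)| = 1 := by rcases hν with rfl | rfl <;> simp
    calc |(1 / 2 : ℝ) * #(I.filter (fun m : ℤ => m ≡ (s : ℤ) [ZMOD d])) +
            (1 / 2) * ν * Lam d s - X / d|
        = |(1 / 2 : ℝ) * ((#(I.filter (fun m : ℤ => m ≡ (s : ℤ) [ZMOD d])) : ℝ) - (#I : ℝ) / d) +
            (1 / 2) * ν * Lam d s| := by rw [hX]; ring_nf
      _ ≤ |(1 / 2 : ℝ) * ((#(I.filter (fun m : ℤ => m ≡ (s : ℤ) [ZMOD d])) : ℝ) - (#I : ℝ) / d)| +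
            |(1 / 2 : ℝ) * ν * Lam d s| := abs_add_le _ _
      _ ≤ (1 / 2) * 1 + (1 / 2) * |Lam d s| := by
          rw [abs_mul, abs_mul, abs_mul, hνabs, abs_of_pos (by norm_num : (0 : ℝ) < 1 / 2)]
          have := mul_le_mul_of_nonneg_left hcnt (by norm_num : (0 : ℝ) ≤ 1 / 2)
          linarith
      _ = (1 / 2) * (1 + |Lam d s|) := by ring
  have hRsum : ∀ ν : ℤ, (ν = 1 ∨ ν = -1) →
      ∑ d ∈ P.divisors.filter (fun d : ℕ => (d : ℝ) ≤ D), |(A ν).remainder d xF| ≤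
        (1 / 2) * ∑ d ∈ (Icc 1 ⌊D⌋₊).filter Squarefree, ∑ s ∈ rootsMod F d, (1 + |Lam d s|) := by
    intro ν hν
    calc _ ≤ ∑ d ∈ P.divisors.filter (fun d : ℕ => (d : ℝ) ≤ D),
          (1 / 2) * ∑ s ∈ rootsMod F d, (1 + |Lam d s|) := Finset.sum_le_sum (hRd ν hν)
      _ = (1 / 2) * ∑ d ∈ P.divisors.filter (fun d : ℕ => (d : ℝ) ≤ D),
          ∑ s ∈ rootsMod F d, (1 + |Lam d s|) := by rw [Finset.mul_sum]
      _ ≤ _ := by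
          refine mul_le_mul_of_nonneg_left ?_ (by norm_num)
          exact Finset.sum_le_sum_of_subset_of_nonneg (divisors_filter_subset z D)
            fun d _ _ => Finset.sum_nonneg fun s _ => by positivity
  -- assembly
  have hsum : ∑ m ∈ I.filter (fun m : ℤ => (F.eval m).natAbs.Coprime P),
      (liouville (a * m + b).toNat : ℝ) = (A 1).sifted xF P - (A (-1)).sifted xF P := by
    rw [hsift 1, hsift (-1)]
    exact sum_liouville_eq_card_sub_card _ (fun m hm => hab m (Finset.mem_filter.mp hm).1)
  rw [hsum]
  have h1 := hFLν 1
  have h2 := hFLν (-1)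
  have hR1 := hRsum 1 (Or.inl rfl)
  have hR2 := hRsum (-1) (Or.inr rfl)
  calc |(A 1).sifted xF P - (A (-1)).sifted xF P|
      = |((A 1).sifted xF P - X * V) - ((A (-1)).sifted xF P - X * V)| := by ring_nf
    _ ≤ |(A 1).sifted xF P - X * V| + |(A (-1)).sifted xF P - X * V| := abs_sub _ _
    _ ≤ (CFL * X * V * E + (1 / 2) * ∑ d ∈ (Icc 1 ⌊D⌋₊).filter Squarefree,
            ∑ s ∈ rootsMod F d, (1 + |Lam d s|)) +
          (CFL * X * V * E + (1 / 2) * ∑ d ∈ (Icc 1 ⌊D⌋₊).filter Squarefree,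
            ∑ s ∈ rootsMod F d, (1 + |Lam d s|)) :=
        add_le_add (h1.trans (add_le_add le_rfl hR1)) (h2.trans (add_le_add le_rfl hR2))
    _ = CFL * #I * V * E + ∑ d ∈ (Icc 1 ⌊D⌋₊).filter Squarefree,
          ∑ s ∈ rootsMod F d, (1 + |Lam d s|) := by rw [hX]; ring

set_option maxHeartbeats 400000 in
/-- **Upper bound for the sifted points of an interval.**
`#{m ∈ I : (F(m), P(z)) = 1} ≤ (1 + C_FL) #I V(z) + ∑_{d ≤ D sqfree} ω_F(d)` for `2 ≤ z ≤ D`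
(Fundamental Lemma for `valSeq F I (#I)`, remainders `|R_d| ≤ ω_F(d)`).
[cite: FriedlanderIwaniecOpera2010, Cor. 6.10] -/
theorem sifted_card_le {κ K CFL : ℝ} (hCFL : 0 ≤ CFL)
    (hFL : ∀ A : SieveSequence, HasSieveDimension A.density κ K →
      ∀ x z D : ℝ, 2 ≤ z → z ≤ D → 0 ≤ A.size x →
        |A.sifted x (primesProdBelow z) - A.size x * A.densityProduct (primesProdBelow z)| ≤
          CFL * A.size x * A.densityProduct (primesProdBelow z) *
              Real.exp (-(Real.log D / Real.log z)) +
            ∑ d ∈ (primesProdBelow z).divisors.filter (fun d : ℕ => (d : ℝ) ≤ D),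
              |A.remainder d x|)
    {F : ℤ[X]} (hdim : HasSieveDimension (rootDensity F) κ K) {m₁ m₂ : ℤ}
    {xF : ℝ} (hxF : ∀ m ∈ Icc m₁ m₂, 0 < F.eval m ∧ ((F.eval m : ℤ) : ℝ) ≤ xF)
    {z D : ℝ} (hz : 2 ≤ z) (hzD : z ≤ D) :
    (#((Icc m₁ m₂).filter (fun m : ℤ => (F.eval m).natAbs.Coprime (primesProdBelow z))) : ℝ) ≤
      (1 + CFL) * #(Icc m₁ m₂) *
          (∏ p ∈ Nat.primesBelow ⌈z⌉₊, (1 - (polyRootCountMod ![F] p : ℝ) / p)) +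
        ∑ d ∈ (Icc 1 ⌊D⌋₊).filter Squarefree, (polyRootCountMod ![F] d : ℝ) := by
  set I := Icc m₁ m₂ with hIdef
  set P := primesProdBelow z with hP
  set V := ∏ p ∈ Nat.primesBelow ⌈z⌉₊, (1 - (polyRootCountMod ![F] p : ℝ) / p) with hVdef
  set E := Real.exp (-(Real.log D / Real.log z)) with hE
  set A : SieveSequence := valSeq F I (#I : ℝ) with hA
  have hX0 : (0 : ℝ) ≤ #I := Nat.cast_nonneg _
  have hV0 : 0 ≤ V := prod_one_sub_rootCount_nonneg F z
  have hsift : A.sifted xF P = #(I.filter (fun m : ℤ => (F.eval m).natAbs.Coprime P)) := by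
    rw [hA, valSeq_sifted F I _ hxF P]
  have h := hFL A hdim xF z D hz hzD hX0
  rw [valSeq_densityProduct, valSeq_size, hsift] at h
  have hE1 : E ≤ 1 := by
    rw [hE, Real.exp_le_one_iff, neg_nonpos]
    exact div_nonneg (Real.log_nonneg (by linarith)) (Real.log_nonneg (by linarith))
  -- remainders
  have hRd : ∀ d ∈ P.divisors.filter (fun d : ℕ => (d : ℝ) ≤ D),
      |A.remainder d xF| ≤ (polyRootCountMod ![F] d : ℝ) := by
    intro d hd
    have hd0 : 0 < d := Nat.pos_of_mem_divisors (Finset.mem_filter.mp hd).1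
    refine (abs_valSeq_remainder_le F I _ hxF hd0).trans ?_
    calc ∑ s ∈ rootsMod F d, |((#(I.filter fun n : ℤ => n ≡ (s : ℤ) [ZMOD d]) : ℝ) - (#I : ℝ) / d)|
        ≤ ∑ _s ∈ rootsMod F d, (1 : ℝ) :=
          Finset.sum_le_sum fun s _ => abs_card_Icc_filter_modEq_sub_le hd0 m₁ m₂ (s : ℤ)
      _ = (polyRootCountMod ![F] d : ℝ) := by
          rw [Finset.sum_const, nsmul_eq_mul, mul_one, card_rootsMod]
  have hRsum : ∑ d ∈ P.divisors.filter (fun d : ℕ => (d : ℝ) ≤ D), |A.remainder d xF| ≤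
      ∑ d ∈ (Icc 1 ⌊D⌋₊).filter Squarefree, (polyRootCountMod ![F] d : ℝ) :=
    (Finset.sum_le_sum hRd).trans
      (Finset.sum_le_sum_of_subset_of_nonneg (divisors_filter_subset z D) fun d _ _ => Nat.cast_nonneg _)
  have hmain : CFL * (#I : ℝ) * V * E ≤ CFL * (#I : ℝ) * V :=
    mul_le_of_le_one_right (by positivity) hE1
  have hab := (abs_le.mp h).2
  linarith

end Summit.Parity.GeneralizedHardyLittlewood.Theorems.AbsoluteUpgrade

end
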